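import Mathlib
import Literature.Computability.AlgebraicComplexity.HessianAtOrigin
import Literature.Computability.AlgebraicComplexity.MignonRessayreBound
import Summits.ValiantsHypothesis.ValiantsHypothesis.Theorems.GrenetZeonTwoDimCoefficientsDefs
import Summits.ValiantsHypothesis.ValiantsHypothesis.Theorems.GrenetZeonTwoDimCoefficientsUnitCase
import Summits.ValiantsHypothesis.ValiantsHypothesis.Theorems.GrenetZeonTwoDimCoefficientsDualUnipotentRankTransfer
import Summits.ValiantsHypothesis.ValiantsHypothesis.Theorems.GrenetZeonTwoDimCoefficientsDualUnipotentFlat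
import Summits.ValiantsHypothesis.ValiantsHypothesis.Theorems.GrenetZeonTwoDimCoefficientsScalingClosureReduction
import Summits.ValiantsHypothesis.ValiantsHypothesis.Theorems.GrenetZeonTwoDimCoefficientsScalingAlgebra

/-!
# Crux `GrenetZeon.TwoDimCoefficients` (stmt-ValiantsHypothesis-8062), stub `stub_dualUnipotent`:
# the SCALING ALGEBRA and the rung `m ≥ 2n` in the unipotent dual model

The scaling-closure argument (✓ `…ScalingClosureReduction.sq_le_of_scalingFamily`: the limit step, closed
by name) needs, from the data `per_n = α·c + β·tr(adj A·B)` (`A, B` affine `m × m`, `det A ≡ c ≠ 0`), a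
polynomial family `P(z, δ)` and a polynomial matrix `H(z, δ)` with `P(z,0) = c + per_n(z)/β`,
`rank Hess per_n(z) ≤ rank H(z,0)` and Mignon–Ressayre off `δ = 0`.  This file BUILDS them when `m < 2n`:

* homogenise the affine entries in `δ` (`a₀ + a₁(x) ↦ δ·a₀ + a₁(z)`, written out, no definition),
  `M := A^h + δ^n·B^h`; pointwise `M(z, δ₀) = δ₀·(A + δ₀^n B)(z/δ₀)` (`eval_homog_eq`);
* `det M = Σ_k δ^{nk}·E_k`, `E_k = [X^k] det(X·B^h + A^h)` (`det_eq_sum_coeff`), and pointwise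
  `E_k(z, δ₀) = δ₀^m·D_k(z/δ₀)`, `D_k = [X^k] det(X·B + A)` (`eval_coeff_det_homog`), with `D_0 = det A`
  (`coeff_det_zero`) and `D_1 = tr(adj A·B)` (`coeff_det_one`, via Mathlib `coeff_det_one_add_X_smul_one`);
* for `m < 2n` the family `P := c + β⁻¹·per_n(z) − αcβ⁻¹·δ^n + Σ_{k≥2} δ^{kn−m}·E_k` is a POLYNOMIAL with
  `δ₀^m·P(z, δ₀) = det M(z, δ₀)` (`eval_det_eq_pow_mul_eval_family`) and `P(z, 0) = c + β⁻¹·per_n(z)`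
  (`eval_family_zero`): all companions `[D_k]_{kn}` vanish since `deg D_k ≤ m < kn`;
* slice calculus: `z`-partials commute with the specialisation `δ := δ₀` (`eval_pderiv_some_slice`), so the
  `z`-Hessian `H` of `P` specialises to `Hess` of the slice polynomial, to which ✓ `rank_hess0_det_le` applies
  through the affine matrix `M(·, δ₀)` (`rank_hess_slice_le`);
* ★ `two_mul_le_of_dualUnipotentRepr` — **`DualUnipotentRepr n m → 2n ≤ m` for `n ≥ 4`** (unconditional;
  improves the tree's `2n² ≤ m² + 4n`, i.e. `m ≳ √2·n`, ✓ `two_mul_sq_le_of_dualUnipotentRepr`, to `m ≥ 2n`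
  in the unipotent dual model): if `m < 2n` the scaling family exists, the limit step gives `n² ≤ 2m < 4n`.

HONEST FRAMING: a constant-factor LINEAR rung in the stub's model (the stub asks for `n² ≤ C·m`); beyond
`m < 2n` the companions `[D_k]_{kn}` survive in the shadow and the method stops (memo SIXTEENTH-HAND.md,
PROFILE-BARRIER).  The stub, the crux and `VP ≠ VNP` remain open.

References: T. Mignon, N. Ressayre, Int. Math. Res. Not. 2004:79, Thm. 1.1 (tree `rank_hess0_det_le`);
J. M. Landsberg, L. Manivel, N. Ressayre, Comment. Math. Helv. 88 (2013) 469–484 (border analogue, not used).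
-/

-- single-conjunct layout `Summits/ValiantsHypothesis/ValiantsHypothesis`: the duplicated namespace
-- component is mandated by the tree.
set_option linter.dupNamespace false
set_option autoImplicit false

noncomputable section

namespace Summit.ValiantsHypothesis.ValiantsHypothesis.Theorems.GrenetZeonTwoDimCoefficients.ScalingClosure

open MvPolynomial Matrix Filter Topology
open Literature.Computability.AlgebraicComplexity
open Summit.ValiantsHypothesis.ValiantsHypothesis.Cruxes.TwoDimCoefficients.DimTwoCases

/-! ### The scaling family for a unipotent dual representation with `m < 2n` -/

section Family

variable {n m : ℕ}

/-- Pointwise, the homogenised pair specialises to the dilated pair: for `δ₀ ≠ 0`,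
`E_k(z, δ₀) = δ₀^m · D_k(z/δ₀)`. [folklore] -/
theorem eval_coeff_det_homog (A B : AffMat n m) (hA : IsAffine A) (hB : IsAffine B)
    (Ah Bh : Matrix (Fin m) (Fin m) (MvPolynomial (Option (Fin n × Fin n)) ℂ))
    (hAh : ∀ i j, Ah i j = rename some (homogeneousComponent 1 (A i j)) +
      MvPolynomial.C (coeff 0 (A i j)) * X none)
    (hBh : ∀ i j, Bh i j = rename some (homogeneousComponent 1 (B i j)) +
      MvPolynomial.C (coeff 0 (B i j)) * X none)
    {d : ℂ} (hd : d ≠ 0) (z : Fin n × Fin n → ℂ) (k : ℕ) :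
    eval (fun o : Option (Fin n × Fin n) => o.elim d z)
        ((det ((Polynomial.X : Polynomial (MvPolynomial (Option (Fin n × Fin n)) ℂ)) • Bh.map Polynomial.C +
          Ah.map Polynomial.C)).coeff k) =
      d ^ m * eval (d⁻¹ • z)
        ((det ((Polynomial.X : Polynomial (MvPolynomial (Fin n × Fin n) ℂ)) • B.map Polynomial.C +
          A.map Polynomial.C)).coeff k) := by
  have hA' : Ah.map (eval (fun o : Option (Fin n × Fin n) => o.elim d z)) =
      d • A.map (eval (d⁻¹ • z)) := by
    ext i j
    rw [Matrix.map_apply, hAh, eval_homog_eq (hA i j) hd, Matrix.smul_apply, Matrix.map_apply,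
      smul_eq_mul]
  have hB' : Bh.map (eval (fun o : Option (Fin n × Fin n) => o.elim d z)) =
      d • B.map (eval (d⁻¹ • z)) := by
    ext i j
    rw [Matrix.map_apply, hBh, eval_homog_eq (hB i j) hd, Matrix.smul_apply, Matrix.map_apply,
      smul_eq_mul]
  rw [← Polynomial.coeff_map, map_det_X_smul_add, hA', hB', coeff_det_smul, Fintype.card_fin,
    ← map_det_X_smul_add, Polynomial.coeff_map]

/-- **The family is `δ^m`-divisible, pointwise.**  With `m < 2n`, `2 ≤ m`, `det A = c`,
`per_n = αc + β·tr(adj A·B)` (`c, β ≠ 0`): for `δ₀ ≠ 0`,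
`det M(z, δ₀) = δ₀^m · P(z, δ₀)` where `M = A^h + δ^n B^h` and
`P = c + β⁻¹ per_n(z) − αcβ⁻¹ δ^n + Σ_{2 ≤ k ≤ m} δ^{kn−m} E_k`. [folklore] -/
theorem eval_det_eq_pow_mul_eval_family (A B : AffMat n m) (hA : IsAffine A) (hB : IsAffine B)
    (α β c : ℂ) (hc : c ≠ 0) (hβ : β ≠ 0) (hdet : A.det = MvPolynomial.C c)
    (hper : perPoly (Fin n) ℂ = MvPolynomial.C α * A.det + MvPolynomial.C β * (A.adjugate * B).trace)
    (hm2 : 2 ≤ m) (hmn : m < 2 * n)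
    (Ah Bh : Matrix (Fin m) (Fin m) (MvPolynomial (Option (Fin n × Fin n)) ℂ))
    (hAh : ∀ i j, Ah i j = rename some (homogeneousComponent 1 (A i j)) +
      MvPolynomial.C (coeff 0 (A i j)) * X none)
    (hBh : ∀ i j, Bh i j = rename some (homogeneousComponent 1 (B i j)) +
      MvPolynomial.C (coeff 0 (B i j)) * X none)
    {d : ℂ} (hd : d ≠ 0) (z : Fin n × Fin n → ℂ) :
    eval (fun o : Option (Fin n × Fin n) => o.elim d z)
        (det ((X none : MvPolynomial (Option (Fin n × Fin n)) ℂ) ^ n • Bh + Ah)) =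
      d ^ m * eval (fun o : Option (Fin n × Fin n) => o.elim d z)
        (MvPolynomial.C c + MvPolynomial.C β⁻¹ * rename some (perPoly (Fin n) ℂ) -
          MvPolynomial.C (α * c * β⁻¹) * (X none) ^ n +
          ∑ k ∈ Finset.range (m + 1), if 2 ≤ k then (X none) ^ (k * n - m) *
            (det ((Polynomial.X : Polynomial (MvPolynomial (Option (Fin n × Fin n)) ℂ)) • Bh.map Polynomial.C +
              Ah.map Polynomial.C)).coeff k else 0) := by
  set x : Option (Fin n × Fin n) → ℂ := fun o => o.elim d z with hx
  set E : ℕ → MvPolynomial (Option (Fin n × Fin n)) ℂ := fun k =>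
    (det ((Polynomial.X : Polynomial (MvPolynomial (Option (Fin n × Fin n)) ℂ)) • Bh.map Polynomial.C +
      Ah.map Polynomial.C)).coeff k with hE
  set D : ℕ → MvPolynomial (Fin n × Fin n) ℂ := fun k =>
    (det ((Polynomial.X : Polynomial (MvPolynomial (Fin n × Fin n) ℂ)) • B.map Polynomial.C +
      A.map Polynomial.C)).coeff k with hD
  have hEk : ∀ k, eval x (E k) = d ^ m * eval (d⁻¹ • z) (D k) := fun k =>
    eval_coeff_det_homog A B hA hB Ah Bh hAh hBh hd z k
  -- `D_0 = c`, `D_1 = (per − αc)/β` at the dilated point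
  have hu : IsUnit A.det := by
    rw [hdet]
    exact (isUnit_iff_ne_zero.mpr hc).map MvPolynomial.C
  have hD0 : eval (d⁻¹ • z) (D 0) = c := by
    simp only [hD, coeff_det_zero, hdet, MvPolynomial.eval_C]
  have hD1 : β * eval (d⁻¹ • z) (D 1) = d⁻¹ ^ n * eval z (perPoly (Fin n) ℂ) - α * c := by
    simp only [hD, coeff_det_one A B hu]
    have h := congrArg (eval (d⁻¹ • z)) hper
    rw [eval_smul_perPoly, map_add, map_mul, map_mul, MvPolynomial.eval_C, MvPolynomial.eval_C, hdet,
      MvPolynomial.eval_C] at h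
    linear_combination -h
  have hXn : eval x (X none : MvPolynomial (Option (Fin n × Fin n)) ℂ) = d := by
    simp only [MvPolynomial.eval_X, hx, Option.elim]
  -- expand `det M(x)` in powers of `δ₀^n`
  have hdetM : eval x (det ((X none : MvPolynomial (Option (Fin n × Fin n)) ℂ) ^ n • Bh + Ah)) =
      ∑ k ∈ Finset.range (m + 1), eval x (E k) * (d ^ n) ^ k := by
    have h := congrArg (eval x) (det_smul_add_eq_sum_coeff ((X none : MvPolynomial
      (Option (Fin n × Fin n)) ℂ) ^ n) Ah Bh)
    rw [Fintype.card_fin, map_sum] at h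
    rw [h]
    refine Finset.sum_congr rfl fun k _ => ?_
    rw [map_mul, map_pow, map_pow, hXn]
  -- peel off `k = 0, 1`
  obtain ⟨m', rfl⟩ : ∃ m', m = m' + 2 := ⟨m - 2, by omega⟩
  have hL : ∑ k ∈ Finset.range (m' + 2 + 1), eval x (E k) * (d ^ n) ^ k =
      eval x (E 0) + eval x (E 1) * d ^ n +
        ∑ k ∈ Finset.range (m' + 1), eval x (E (k + 1 + 1)) * (d ^ n) ^ (k + 1 + 1) := by
    rw [Finset.sum_range_succ', Finset.sum_range_succ']
    ring
  have hper' : eval x (rename some (perPoly (Fin n) ℂ)) = eval z (perPoly (Fin n) ℂ) := by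
    rw [MvPolynomial.eval_rename]
    rfl
  have h20 : ¬ (2 ≤ 0) := by omega
  have h21 : ¬ (2 ≤ 0 + 1) := by omega
  have hR : ∑ k ∈ Finset.range (m' + 2 + 1), eval x (if 2 ≤ k then
      (X none : MvPolynomial (Option (Fin n × Fin n)) ℂ) ^ (k * n - (m' + 2)) * E k else 0) =
      ∑ k ∈ Finset.range (m' + 1), d ^ ((k + 1 + 1) * n - (m' + 2)) * eval x (E (k + 1 + 1)) := by
    rw [Finset.sum_range_succ', Finset.sum_range_succ']
    simp only [h20, h21, if_false, map_zero, add_zero]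
    refine Finset.sum_congr rfl fun k _ => ?_
    rw [if_pos (by omega), map_mul, map_pow, hXn]
  have htail : ∑ k ∈ Finset.range (m' + 1), eval x (E (k + 1 + 1)) * (d ^ n) ^ (k + 1 + 1) =
      d ^ (m' + 2) * ∑ k ∈ Finset.range (m' + 1),
        d ^ ((k + 1 + 1) * n - (m' + 2)) * eval x (E (k + 1 + 1)) := by
    rw [Finset.mul_sum]
    refine Finset.sum_congr rfl fun k _ => ?_
    have hle : m' + 2 ≤ (k + 1 + 1) * n := by nlinarith
    rw [← pow_mul, show n * (k + 1 + 1) = (m' + 2) + ((k + 1 + 1) * n - (m' + 2)) by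
      rw [mul_comm]; omega, pow_add]
    ring
  rw [hdetM, map_add, map_sub, map_add, map_mul, map_mul, MvPolynomial.eval_C, MvPolynomial.eval_C,
    MvPolynomial.eval_C, map_pow, hXn, map_sum, hper', hL, hR, hEk 0, hEk 1, hD0]
  have hdn : d⁻¹ ^ n * d ^ n = 1 := by rw [← mul_pow, inv_mul_cancel₀ hd, one_pow]
  have hβi : β * β⁻¹ = 1 := mul_inv_cancel₀ hβ
  linear_combination htail + (β⁻¹ * d ^ (m' + 2) * d ^ n) * hD1 -
    (d ^ (m' + 2) * d ^ n * eval (d⁻¹ • z) (D 1)) * hβi +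
    (β⁻¹ * d ^ (m' + 2) * eval z (perPoly (Fin n) ℂ)) * hdn

/-- **The special fibre.**  `P(z, 0) = c + β⁻¹·per_n(z)` (`n ≥ 1`, `m < 2n`). [folklore] -/
theorem eval_family_zero (n m : ℕ) (hn : 1 ≤ n) (hmn : m < 2 * n) (α β c : ℂ)
    (E : ℕ → MvPolynomial (Option (Fin n × Fin n)) ℂ) (z : Fin n × Fin n → ℂ) :
    eval (fun o : Option (Fin n × Fin n) => o.elim 0 z)
        (MvPolynomial.C c + MvPolynomial.C β⁻¹ * rename some (perPoly (Fin n) ℂ) -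
          MvPolynomial.C (α * c * β⁻¹) * (X none) ^ n +
          ∑ k ∈ Finset.range (m + 1), if 2 ≤ k then (X none) ^ (k * n - m) * E k else 0) =
      c + β⁻¹ * eval z (perPoly (Fin n) ℂ) := by
  rw [map_add, map_sub, map_add, map_mul, map_mul, MvPolynomial.eval_C, MvPolynomial.eval_C,
    MvPolynomial.eval_C, map_pow, MvPolynomial.eval_X, map_sum, MvPolynomial.eval_rename]
  have hcomp : ((fun o : Option (Fin n × Fin n) => o.elim (0 : ℂ) z) ∘ some) = z :=
    funext fun _ => rfl
  rw [hcomp]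
  have hsum : ∑ k ∈ Finset.range (m + 1), eval (fun o : Option (Fin n × Fin n) => o.elim 0 z)
      (if 2 ≤ k then (X none) ^ (k * n - m) * E k else 0) = 0 := by
    refine Finset.sum_eq_zero fun k _ => ?_
    split_ifs with hk
    · have hpos : k * n - m ≠ 0 := by
        have : 2 * n ≤ k * n := Nat.mul_le_mul_right n hk
        omega
      rw [map_mul, map_pow, MvPolynomial.eval_X]
      simp [Option.elim, zero_pow hpos]
    · exact map_zero _
  rw [hsum]
  simp [Option.elim, zero_pow (by omega : n ≠ 0)]

end Family

/-! ### The rung `m ≥ 2n` -/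

section Rung

/-- ★ **`DualUnipotentRepr n m → 2n ≤ m` for `n ≥ 4` (unconditional).**  If `m < 2n`, homogenise the
representation in `δ`, form the scaling family `P` (all companions `[D_k]_{kn}`, `k ≥ 2`, vanish because
`deg D_k ≤ m < kn`) and its `z`-Hessian `H`; the special fibre is `c + β⁻¹·per_n`, Mignon–Ressayre holds on
every slice `δ = δ₀ ≠ 0` through the affine matrix `M(·, δ₀)`, and the limit step
✓ `sq_le_of_scalingFamily` gives `n² ≤ 2m < 4n`, absurd.  (`m ≤ 1` is excluded by the flatness rung
✓ `two_mul_sq_le_of_dualUnipotentRepr`.)  Improves `m ≳ √2·n` to `m ≥ 2n` in the unipotent dual model;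
the stub asks for `n² ≤ C·m`. [cite: MignonRessayre2004, Thm. 1.1 — via the tree; folklore scaling] -/
theorem two_mul_le_of_dualUnipotentRepr {n m : ℕ} (hn : 4 ≤ n) (h : DualUnipotentRepr n m) :
    2 * n ≤ m := by
  classical
  by_contra hlt
  rw [not_le] at hlt
  have hflat := two_mul_sq_le_of_dualUnipotentRepr h
  have hm2 : 2 ≤ m := by nlinarith
  obtain ⟨α, β, c, A, B, hA, hB, hc, hdet, hper⟩ := h
  obtain ⟨k, rfl⟩ : ∃ k, n = k + 3 := ⟨n - 3, by omega⟩
  have hβ : β ≠ 0 := by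
    intro hβ0
    apply perPoly_ne_C (n := k + 3) (by omega) (α * c)
    rw [hper, hdet, hβ0, map_zero, zero_mul, add_zero, ← map_mul]
  -- homogenised matrices, the family `P` and its `z`-Hessian `H`
  set Ah : Matrix (Fin m) (Fin m) (MvPolynomial (Option (Fin (k + 3) × Fin (k + 3))) ℂ) :=
    Matrix.of fun i j => rename some (homogeneousComponent 1 (A i j)) +
      MvPolynomial.C (coeff 0 (A i j)) * X none with hAh_def
  set Bh : Matrix (Fin m) (Fin m) (MvPolynomial (Option (Fin (k + 3) × Fin (k + 3))) ℂ) :=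
    Matrix.of fun i j => rename some (homogeneousComponent 1 (B i j)) +
      MvPolynomial.C (coeff 0 (B i j)) * X none with hBh_def
  have hAh : ∀ i j, Ah i j = rename some (homogeneousComponent 1 (A i j)) +
      MvPolynomial.C (coeff 0 (A i j)) * X none := fun i j => rfl
  have hBh : ∀ i j, Bh i j = rename some (homogeneousComponent 1 (B i j)) +
      MvPolynomial.C (coeff 0 (B i j)) * X none := fun i j => rfl
  set E : ℕ → MvPolynomial (Option (Fin (k + 3) × Fin (k + 3))) ℂ := fun k' =>
    (det ((Polynomial.X : Polynomial (MvPolynomial (Option (Fin (k + 3) × Fin (k + 3))) ℂ)) •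
      Bh.map Polynomial.C + Ah.map Polynomial.C)).coeff k' with hE
  set P : MvPolynomial (Option (Fin (k + 3) × Fin (k + 3))) ℂ :=
    MvPolynomial.C c + MvPolynomial.C β⁻¹ * rename some (perPoly (Fin (k + 3)) ℂ) -
      MvPolynomial.C (α * c * β⁻¹) * (X none) ^ (k + 3) +
      ∑ k' ∈ Finset.range (m + 1), if 2 ≤ k' then (X none) ^ (k' * (k + 3) - m) * E k' else 0
    with hP
  set H : Matrix (Fin (k + 3) × Fin (k + 3)) (Fin (k + 3) × Fin (k + 3))
      (MvPolynomial (Option (Fin (k + 3) × Fin (k + 3))) ℂ) :=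
    Matrix.of fun s t => pderiv (some s) (pderiv (some t) P) with hH
  -- (h0) the special fibre
  have h0 : ∀ z : Fin (k + 3) × Fin (k + 3) → ℂ,
      eval (fun o : Option (Fin (k + 3) × Fin (k + 3)) => o.elim (0 : ℂ) z) P =
        c + β⁻¹ * eval z (perPoly (Fin (k + 3)) ℂ) :=
    fun z => eval_family_zero (k + 3) m (by omega) hlt α β c E z
  have h0' : ∀ z : Fin (k + 3) × Fin (k + 3) → ℂ,
      eval (fun o : Option (Fin (k + 3) × Fin (k + 3)) => o.elim (0 : ℂ) z) P =
        eval z (MvPolynomial.C c + MvPolynomial.C β⁻¹ * perPoly (Fin (k + 3)) ℂ) := by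
    intro z
    rw [h0 z, map_add, map_mul, MvPolynomial.eval_C, MvPolynomial.eval_C]
  -- (hH) the Hessian on the special fibre
  have hH0 : ∀ z : Fin (k + 3) × Fin (k + 3) → ℂ,
      (hess0 (transl z (perPoly (Fin (k + 3)) ℂ))).rank ≤
        (H.map (eval (fun o : Option (Fin (k + 3) × Fin (k + 3)) => o.elim (0 : ℂ) z))).rank := by
    intro z
    have hT : hess0 (transl z (MvPolynomial.C c + MvPolynomial.C β⁻¹ * perPoly (Fin (k + 3)) ℂ)) =
        β⁻¹ • hess0 (transl z (perPoly (Fin (k + 3)) ℂ)) := by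
      rw [map_add, map_mul, transl_C, transl_C, map_add, hess0_C_mul,
        hess0_eq_zero_of_totalDegree_le_one ((totalDegree_C c).le.trans zero_le_one), zero_add]
    rw [hH, hessian_slice P _ 0 h0' z, hT, rank_smul_eq (inv_ne_zero hβ)]
  -- (hMR) Mignon–Ressayre on the slices `δ = δ₀ ≠ 0`
  have hMR : ∀ x : Option (Fin (k + 3) × Fin (k + 3)) → ℂ, x none ≠ 0 → eval x P = 0 →
      (H.map (eval x)).rank ≤ 2 * m := by
    intro x hx0 hxP
    set d : ℂ := x none with hd
    set z : Fin (k + 3) × Fin (k + 3) → ℂ := fun s => x (some s) with hz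
    have hx : x = fun o : Option (Fin (k + 3) × Fin (k + 3)) => o.elim d z := by
      funext o
      cases o <;> rfl
    set g : Option (Fin (k + 3) × Fin (k + 3)) → MvPolynomial (Fin (k + 3) × Fin (k + 3)) ℂ :=
      fun o => o.elim (MvPolynomial.C d) X with hg
    set Pd : MvPolynomial (Fin (k + 3) × Fin (k + 3)) ℂ := aeval g P with hPd
    have hslice : ∀ z' : Fin (k + 3) × Fin (k + 3) → ℂ,
        eval (fun o : Option (Fin (k + 3) × Fin (k + 3)) => o.elim d z') P = eval z' Pd :=
      fun z' => (eval_aeval_slice P d z').symm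
    have hHx : H.map (eval x) = hess0 (transl z Pd) := by
      rw [hx, hH]
      exact hessian_slice P Pd d hslice z
    -- the affine matrix on the slice and its determinant
    set Md : Matrix (Fin m) (Fin m) (MvPolynomial (Fin (k + 3) × Fin (k + 3)) ℂ) :=
      ((X none : MvPolynomial (Option (Fin (k + 3) × Fin (k + 3))) ℂ) ^ (k + 3) • Bh + Ah).map
        (aeval g) with hMd
    have hgX : aeval g (X none : MvPolynomial (Option (Fin (k + 3) × Fin (k + 3))) ℂ) =
        MvPolynomial.C d := by
      rw [MvPolynomial.aeval_X, hg]
      rfl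
    have hMd_aff : ∀ i j, (Md i j).totalDegree ≤ 1 := by
      intro i j
      rw [hMd, Matrix.map_apply, Matrix.add_apply, Matrix.smul_apply, map_add, smul_eq_mul, map_mul,
        map_pow, hgX, ← map_pow]
      refine (totalDegree_add _ _).trans (max_le ?_ ?_)
      · refine (totalDegree_mul _ _).trans ?_
        rw [totalDegree_C, zero_add]
        exact totalDegree_aeval_homog_le d
      · exact totalDegree_aeval_homog_le d
    have hdetMd : Md.det = MvPolynomial.C (d ^ m) * Pd := by
      apply MvPolynomial.funext
      intro z'
      have h1 := eval_det_eq_pow_mul_eval_family A B hA hB α β c hc hβ hdet hper hm2 hlt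
        Ah Bh hAh hBh hx0 z'
      rw [map_mul, MvPolynomial.eval_C, hPd, eval_aeval_slice, hMd, ← AlgHom.mapMatrix_apply,
        ← AlgHom.map_det, eval_aeval_slice]
      exact h1
    -- Mignon–Ressayre for the translated affine matrix
    set A' : Matrix (Fin m) (Fin m) (MvPolynomial (Fin (k + 3) × Fin (k + 3)) ℂ) :=
      (transl z).mapMatrix Md with hA'
    have hA'aff : ∀ i j, (A' i j).totalDegree ≤ 1 := fun i j => by
      rw [hA', AlgHom.mapMatrix_apply, Matrix.map_apply]
      exact (totalDegree_transl_le _ _).trans (hMd_aff i j)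
    have hA'det : A'.det = MvPolynomial.C (d ^ m) * transl z Pd := by
      rw [hA', ← AlgHom.map_det, hdetMd, map_mul, transl_C]
    have hcc : constantCoeff A'.det = 0 := by
      rw [hA'det, map_mul, constantCoeff_C, constantCoeff_transl, ← hslice z, ← hx, hxP, mul_zero]
    have hr := rank_hess0_det_le A' hA'aff hcc
    rw [hA'det, hess0_C_mul, rank_smul_eq (pow_ne_zero _ hx0)] at hr
    rw [hHx]
    exact hr
  have hsq := sq_le_of_scalingFamily (r := 2 * m) P H c β⁻¹ hc (inv_ne_zero hβ) h0 hH0 hMR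
  nlinarith [hsq, hlt]

end Rung

end Summit.ValiantsHypothesis.ValiantsHypothesis.Theorems.GrenetZeonTwoDimCoefficients.ScalingClosure

end
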